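import Mathlib.Algebra.MvPolynomial.CommRing
import Mathlib.RingTheory.Ideal.Span
import Mathlib.Tactic.Ring
import Mathlib.Tactic.FinCases
import Mathlib.Tactic.NormNum
import Summits.ResolutionOfSingularities.ResolutionOfSingularities.Theorems.FrobeniusLadderFInjectiveMacaulayficationThreefoldIdentities
import HarnessLib

/-!
# The threefold forms: no chart variable divides `f` or its strict transforms

Support file for crux stmt-ResolutionOfSingularities-15315
(`FrobeniusLadder.FInjectiveMacaulayfication`, line `Sketch`, §13 THE THREEFOLD CALIBRATION):
stub `stub_threefoldNotDvd` — the side conditions of the primality transfer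
`PrimeTransfer.stub_primeTransfer` for the germ
`f = X₀²X₁ + X₁²X₂ + X₂²X₀ + X₀X₃³ + X₁X₂X₃² ∈ k[X₀, X₁, X₂, X₃]` and its strict transforms on the
four charts of the blow-up of the origin,

* `g₀ = X₁ + X₁²X₂ + X₂² + X₀X₃³ + X₀X₁X₂X₃²`,
* `g₁ = X₀² + X₂ + X₀X₂² + X₀X₁X₃³ + X₁X₂X₃²`,
* `g₂ = X₀²X₁ + X₁² + X₀ + X₀X₂X₃³ + X₁X₂X₃²`,
* `g₃ = X₀²X₁ + X₁²X₂ + X₂²X₀ + X₀X₃ + X₁X₂X₃`: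

`Xᵢ ∤ f` for every `i`, and `Xᵢ ∤ gᵢ`, phrased as non-membership in the principal ideals `(Xᵢ)`.
Everything holds over EVERY field `k` (the calibration itself lives in characteristic `2`).

Method (`not_mem_span_X_of_eval_eq_one`): to refute `h ∈ (Xᵢ)`, evaluate at a point `a` with
`aᵢ = 0` and `h(a) = 1` — the evaluation `k[X] → k` at `a` kills `Xᵢ`, hence all of `(Xᵢ)`, but
not `h` (`ThreefoldIdentities.not_mem_span_singleton_of_map`, imported). The points used:
`f ∉ (X₀)` at `(0,1,1,0)`; `f ∉ (X₁)` at `(1,0,1,0)`; `f ∉ (X₂)`, `f ∉ (X₃)` and `g₃ ∉ (X₃)` at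
`(1,1,0,0)`; `g₀ ∉ (X₀)` and `g₂ ∉ (X₂)` at `(0,1,0,0)`; `g₁ ∉ (X₁)` at `(0,0,1,0)`. At each of
these points exactly one monomial of the polynomial survives, with value `1`.

The algebra is folklore.
-/

-- single-problem summit: the doubled namespace component is forced
set_option linter.dupNamespace false

namespace Summit.ResolutionOfSingularities.ResolutionOfSingularities.Theorems.FInjectiveMacaulayfication.ThreefoldNotDvd

open MvPolynomial

/-- **Evaluation test against a variable.** If `a i = 0` and `h(a) = 1`, then `h ∉ (X i)`: the
evaluation at `a` kills `X i` but not `h`. [folklore] -/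
theorem not_mem_span_X_of_eval_eq_one {k : Type*} [Field k] {n : ℕ} (i : Fin n) (a : Fin n → k)
    (ha : a i = 0) {h : MvPolynomial (Fin n) k} (hh : MvPolynomial.eval a h = 1) :
    h ∉ Ideal.span {(X i : MvPolynomial (Fin n) k)} :=
  ThreefoldIdentities.not_mem_span_singleton_of_map (MvPolynomial.eval a)
    (by rw [MvPolynomial.eval_X, ha]) (by rw [hh]; exact one_ne_zero)

/-- **The threefold forms — no chart variable divides** (registered stub `stub_threefoldNotDvd` of
the §13 calibration; pure polynomial algebra over ANY field): for
`f = X₀²X₁ + X₁²X₂ + X₂²X₀ + X₀X₃³ + X₁X₂X₃²` and its strict transforms `g₀, g₁, g₂, g₃` on the four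
charts of the point blow-up, `f ∉ (Xᵢ)` for every `i` and `gᵢ ∉ (Xᵢ)` — the side conditions of the
primality transfer `(f)` prime `↔` `(gᵢ)` prime. Proof: evaluate at a point with `i`-th coordinate
`0` where the polynomial takes the value `1` (`not_mem_span_X_of_eval_eq_one`). [folklore] -/
theorem stub_threefoldNotDvd : ∀ (k : Type) [Field k] (f g₀ g₁ g₂ g₃ : MvPolynomial (Fin 4) k),
    f = MvPolynomial.X 0 ^ 2 * MvPolynomial.X 1 + MvPolynomial.X 1 ^ 2 * MvPolynomial.X 2 + MvPolynomial.X 2 ^ 2 * MvPolynomial.X 0 + MvPolynomial.X 0 * MvPolynomial.X 3 ^ 3 + MvPolynomial.X 1 * MvPolynomial.X 2 * MvPolynomial.X 3 ^ 2 →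
    g₀ = MvPolynomial.X 1 + MvPolynomial.X 1 ^ 2 * MvPolynomial.X 2 + MvPolynomial.X 2 ^ 2 + MvPolynomial.X 0 * MvPolynomial.X 3 ^ 3 + MvPolynomial.X 0 * MvPolynomial.X 1 * MvPolynomial.X 2 * MvPolynomial.X 3 ^ 2 →
    g₁ = MvPolynomial.X 0 ^ 2 + MvPolynomial.X 2 + MvPolynomial.X 0 * MvPolynomial.X 2 ^ 2 + MvPolynomial.X 0 * MvPolynomial.X 1 * MvPolynomial.X 3 ^ 3 + MvPolynomial.X 1 * MvPolynomial.X 2 * MvPolynomial.X 3 ^ 2 →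
    g₂ = MvPolynomial.X 0 ^ 2 * MvPolynomial.X 1 + MvPolynomial.X 1 ^ 2 + MvPolynomial.X 0 + MvPolynomial.X 0 * MvPolynomial.X 2 * MvPolynomial.X 3 ^ 3 + MvPolynomial.X 1 * MvPolynomial.X 2 * MvPolynomial.X 3 ^ 2 →
    g₃ = MvPolynomial.X 0 ^ 2 * MvPolynomial.X 1 + MvPolynomial.X 1 ^ 2 * MvPolynomial.X 2 + MvPolynomial.X 2 ^ 2 * MvPolynomial.X 0 + MvPolynomial.X 0 * MvPolynomial.X 3 + MvPolynomial.X 1 * MvPolynomial.X 2 * MvPolynomial.X 3 →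
    (∀ i : Fin 4, f ∉ Ideal.span {(MvPolynomial.X i : MvPolynomial (Fin 4) k)}) ∧
    g₀ ∉ Ideal.span {(MvPolynomial.X 0 : MvPolynomial (Fin 4) k)} ∧ g₁ ∉ Ideal.span {(MvPolynomial.X 1 : MvPolynomial (Fin 4) k)} ∧
    g₂ ∉ Ideal.span {(MvPolynomial.X 2 : MvPolynomial (Fin 4) k)} ∧ g₃ ∉ Ideal.span {(MvPolynomial.X 3 : MvPolynomial (Fin 4) k)} := by
  intro k _ f g₀ g₁ g₂ g₃ hf hg₀ hg₁ hg₂ hg₃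
  -- `f ∉ (X₀)`: `f(0,1,1,0) = 1`
  have hf₀ : f ∉ Ideal.span {(MvPolynomial.X 0 : MvPolynomial (Fin 4) k)} := by
    subst hf
    refine not_mem_span_X_of_eval_eq_one 0 (fun j : Fin 4 => if j = 1 ∨ j = 2 then (1 : k) else 0)
      (by simp) ?_
    simp only [map_add, map_mul, map_pow, MvPolynomial.eval_X, Fin.isValue, Fin.reduceEq,
      or_true, or_false, ↓reduceIte]
    ring
  -- `f ∉ (X₁)`: `f(1,0,1,0) = 1`
  have hf₁ : f ∉ Ideal.span {(MvPolynomial.X 1 : MvPolynomial (Fin 4) k)} := by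
    subst hf
    refine not_mem_span_X_of_eval_eq_one 1 (fun j : Fin 4 => if j = 0 ∨ j = 2 then (1 : k) else 0)
      (by simp) ?_
    simp only [map_add, map_mul, map_pow, MvPolynomial.eval_X, Fin.isValue, Fin.reduceEq,
      or_true, or_false, ↓reduceIte]
    ring
  -- `f(1,1,0,0) = 1`, and this point has vanishing `X₂`- and `X₃`-coordinates
  have hf₂₃ : MvPolynomial.eval (fun j : Fin 4 => if j = 0 ∨ j = 1 then (1 : k) else 0) f = 1 := by
    subst hf
    simp only [map_add, map_mul, map_pow, MvPolynomial.eval_X, Fin.isValue, Fin.reduceEq,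
      or_true, or_false, ↓reduceIte]
    ring
  refine ⟨fun i => ?_, ?_, ?_, ?_, ?_⟩
  · fin_cases i
    · exact hf₀
    · exact hf₁
    · exact not_mem_span_X_of_eval_eq_one 2 _ (by simp) hf₂₃
    · exact not_mem_span_X_of_eval_eq_one 3 _ (by simp) hf₂₃
  · -- `g₀ ∉ (X₀)`: `g₀(0,1,0,0) = 1`
    subst hg₀
    refine not_mem_span_X_of_eval_eq_one 0 (fun j : Fin 4 => if j = 1 then (1 : k) else 0)
      (by simp) ?_
    simp only [map_add, map_mul, map_pow, MvPolynomial.eval_X, Fin.isValue, Fin.reduceEq,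
      ↓reduceIte]
    ring
  · -- `g₁ ∉ (X₁)`: `g₁(0,0,1,0) = 1`
    subst hg₁
    refine not_mem_span_X_of_eval_eq_one 1 (fun j : Fin 4 => if j = 2 then (1 : k) else 0)
      (by simp) ?_
    simp only [map_add, map_mul, map_pow, MvPolynomial.eval_X, Fin.isValue, Fin.reduceEq,
      ↓reduceIte]
    ring
  · -- `g₂ ∉ (X₂)`: `g₂(0,1,0,0) = 1`
    subst hg₂
    refine not_mem_span_X_of_eval_eq_one 2 (fun j : Fin 4 => if j = 1 then (1 : k) else 0)
      (by simp) ?_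
    simp only [map_add, map_mul, map_pow, MvPolynomial.eval_X, Fin.isValue, Fin.reduceEq,
      ↓reduceIte]
    ring
  · -- `g₃ ∉ (X₃)`: `g₃(1,1,0,0) = 1`
    subst hg₃
    refine not_mem_span_X_of_eval_eq_one 3 (fun j : Fin 4 => if j = 0 ∨ j = 1 then (1 : k) else 0)
      (by simp) ?_
    simp only [map_add, map_mul, map_pow, MvPolynomial.eval_X, Fin.isValue, Fin.reduceEq,
      or_true, or_false, ↓reduceIte]
    ring

end Summit.ResolutionOfSingularities.ResolutionOfSingularities.Theorems.FInjectiveMacaulayfication.ThreefoldNotDvd
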